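/-
Copyright (c) 2026. All rights reserved.
Released under Apache 2.0 license as described in the file LICENSE.
-/
import Literature.NumberTheory.Automorphic.QuaternionicSIdealClassesAdmissible
import HarnessLib

/-!
# Sign twists of quaternionic modular forms: under `χ`-admissibility `M^{χ ε}(O) = u_χ · M^{ε}(O)`, and the weight-zero
# core of Martin's congruence theorem (`φ' ≡ φ mod 2` with prescribed signs) (Martin 2018, §5.2 Thm. 12, Cor. 14)

[tag: quaternion_algebra] [tag: eichler_order] [tag: hecke_operator]

Topic `NumberTheory/Automorphic`. Lane `lit-hodgefound`, seat p12, gen 52 — sequel of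
`QuaternionicSIdealClassesAdmissible.lean` (Martin's `χ`-admissible `T`-classes, Prop. 7, Cor. 8).

[Martin2018, §5.2, Theorem 12 and its proof] (weight `k`, here `k = 0`): "Suppose each `X ∈ Cl_S(O)` is `χ`-admissible
… Let `ε` be the sign pattern for `𝔐` such that `φ ∈ M_k^ε(O)`. … We define a function `φ'` on `Cl(O)` as follows. For
`1 ≤ i ≤ t`, let `φ'(x_i) = φ(x_i)`. Extend `φ'` to `Cl(O)` by requiring `φ'(x_i) = χ_𝔭 ρ_k(γ_{i,𝔭}) φ'(σ_𝔭(x_i))` for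
all `i, 𝔭`. Then `φ' ∈ M_k^χ(O)` …, and `φ'(x_i) = ± φ(x_i)` for `1 ≤ i ≤ h`. Thus `φ' ≡ φ mod 2` with respect to
`x_1, …, x_h`." (The remaining step of Theorem 12 — the Deligne–Serre lifting lemma producing an EIGENFORM — and the
Jacquet–Langlands transfer of Cor. 13–14 are not formalised here.)

For a Brandt setup `S` (an Eichler order `O` of level `N⁺` in the definite quaternion algebra of discriminant `N⁻` over
`ℚ`), a finite `T`, and sign patterns `χ, ε : T → {±1}`:

* §1 GLOBAL SIGN FUNCTIONS: **`forall_isAdmissible_iff_exists_signFunction`** — every `T`-class is `χ`-admissible iff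
  there is `u : Cls O → {±1}` with `u(W_r x) = χ_r u(x)` for all `x` and `r ∈ T` (glue the admissible partitions);
  `apply_atkinLehnerHom_of_signFunction` (`u(Φ_T(g) x) = χ(g) u(x)`), `forall_isAdmissible_mul` (the admissible-everywhere
  patterns form a subgroup);
* §2 SIGN TWISTS: **`mul_mem_signSpace_mul`** (`u · φ ∈ M^{χ ε}(O)` for `φ ∈ M^ε(O)`),
  `finrank_signSpace_le_finrank_signSpace_mul`, ★ **`finrank_signSpace_mul_eq_of_forall_isAdmissible`** (`dim M^{χ ε}(O) =
  dim M^ε(O)` for every `ε` when all classes are `χ`-admissible: twisting by `u_χ` permutes the sign spaces),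
  `finrank_signSpace_eq_finrank_signSpace_one_of_forall_isAdmissible` (Cor. 8, structurally), **`mem_signSpace_mul_iff_exists`**
  (`M^{χ ε}(O) = u_χ · M^ε(O)`) and **`mem_signSpace_iff_exists_comp_sClassOf`** (`M^χ(O) = u_χ · M^{+_T}(O)`: the forms of
  pattern `χ` are the twisted `T`-class functions);
* §3 ★★ **`exists_mem_signSpace_eq_or_eq_neg`** (THEOREM 12, weight-`0` core: all classes `χ`-admissible, `φ ∈ M^ε(O)` ⇒
  there is `φ' ∈ M^χ(O)` with `φ'(x) = ± φ(x)` for every class `x`, `φ' = φ` at chosen base points, `φ' ≠ 0` if `φ ≠ 0`),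
  **`exists_mem_signSpace_sub_even`** ("`φ' ≡ φ mod 2`" for integral `φ`), and the unconditional case `χ = +_T`
  (**`exists_mem_signSpace_one_eq_or_eq_neg`**, the weight-`0` core of Cor. 14: "since, in weight `0`, all quaternionic
  `S`-ideal classes are `+_𝔐`-admissible").

## References

* [Martin2018] K. Martin, *Congruences for modular forms mod 2 and quaternionic `S`-ideal classes*, Canad. J. Math. 70
  (2018) 1076–1095 (held: arXiv 1701.07864): §4.4 (admissibility), §5.1 (integral forms, congruence "with respect to
  `x_1, …, x_h`"), §5.2 Theorem 12 (proof), Corollary 14.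
* [Voight2021] J. Voight, *Quaternion Algebras*, GTM 288 (2021): (41.3.5).

## Scope (honest)

Weight `0`, `F = ℚ`, Eichler level with the level involutions admitted, rational coefficients. Theorem 12's conclusion
about Hecke EIGENVALUES (Deligne–Serre) is out of scope: only the construction of the sign-twisted form `φ'` and its
congruence to `φ` are proved. Theorems only; no definition, no named fact, no instance.
-/

noncomputable section

open scoped Pointwise

namespace Literature.NumberTheory.Automorphic

namespace Brandt

variable {Nplus Nminus : ℕ} (S : XiSetup Nplus Nminus) {T : Finset ℕ}

/-! ## §1 Global sign functions -/

/-- **Every `T`-class is `χ`-admissible iff the admissible partitions glue to a global sign function**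
`u : Cls O → {±1}` with `u(W_r x) = χ_r u(x)` for all classes `x` and all `r ∈ T`.
[cite: Martin2018, §4.4 (definition of `χ`-admissible) and §5.2 (proof of Thm. 12)] -/
theorem XiSetup.forall_isAdmissible_iff_exists_signFunction (χ : T → ℤˣ) :
    (∀ X : S.SClassSet T, S.IsAdmissible T χ X) ↔
      ∃ u : ClassSet S.O → ℤˣ, ∀ (r : T) (x : ClassSet S.O), u (S.atkinLehner r x) = χ r * u x := by
  constructor
  · intro h
    choose s hs using h
    refine ⟨fun x => s (S.sClassOf T x) x, fun r x => ?_⟩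
    show s (S.sClassOf T (S.atkinLehner r x)) (S.atkinLehner r x) = χ r * s (S.sClassOf T x) x
    rw [S.sClassOf_atkinLehner]
    exact hs (S.sClassOf T x) x rfl r
  · rintro ⟨u, hu⟩ X
    exact ⟨u, fun c _ r => hu r c⟩

/-- **`u(Φ_T(g) x) = χ(g) u(x)`** for a global sign function. [cite: Martin2018, §5.2 (proof of Thm. 12)] -/
theorem XiSetup.apply_atkinLehnerHom_of_signFunction {χ : T → ℤˣ} {u : ClassSet S.O → ℤˣ}
    (hu : ∀ (r : T) (x : ClassSet S.O), u (S.atkinLehner r x) = χ r * u x) (g : T → Multiplicative (ZMod 2))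
    (x : ClassSet S.O) : u (S.atkinLehnerHom T g x) = signCharacter T χ g * u x :=
  XiSetup.IsAdmissible.apply_atkinLehnerHom S (X := S.sClassOf T x) (fun c _ r => hu r c) g rfl

/-- A global sign function for `χ` and one for `χ'` multiply to one for `χ χ'`: **the patterns that are admissible on
every class form a subgroup.** [cite: Martin2018, §4.4] -/
theorem XiSetup.forall_isAdmissible_mul {χ χ' : T → ℤˣ} (h : ∀ X : S.SClassSet T, S.IsAdmissible T χ X)
    (h' : ∀ X : S.SClassSet T, S.IsAdmissible T χ' X) : ∀ X : S.SClassSet T, S.IsAdmissible T (χ * χ') X := by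
  obtain ⟨u, hu⟩ := (S.forall_isAdmissible_iff_exists_signFunction χ).mp h
  obtain ⟨u', hu'⟩ := (S.forall_isAdmissible_iff_exists_signFunction χ').mp h'
  refine (S.forall_isAdmissible_iff_exists_signFunction (χ * χ')).mpr ⟨fun x => u x * u' x, fun r x => ?_⟩
  show u (S.atkinLehner r x) * u' (S.atkinLehner r x) = (χ * χ') r * (u x * u' x)
  rw [hu, hu', Pi.mul_apply]
  exact mul_mul_mul_comm _ _ _ _

/-- The trivial pattern has the trivial global sign function. [cite: Martin2018, §4.4 ("if `χ = +_𝔐` … always a `χ`-admissible partition")] -/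
theorem XiSetup.exists_signFunction_one :
    ∃ u : ClassSet S.O → ℤˣ, ∀ (r : T) (x : ClassSet S.O), u (S.atkinLehner r x) = (1 : T → ℤˣ) r * u x :=
  ⟨fun _ => 1, fun r _ => by rw [Pi.one_apply, one_mul]⟩

/-! ## §2 Sign twists `φ ↦ u · φ` -/

/-- `u · (u · φ) = φ` (`u² = 1`). [folklore] -/
private theorem signFunction_mul_signFunction_mul {X : Type*} (u : X → ℤˣ) (v : X → ℚ) :
    (fun x => ((u x : ℤ) : ℚ) * (((u x : ℤ) : ℚ) * v x)) = v := by
  funext x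
  rw [← mul_assoc, ← Int.cast_mul, ← Units.val_mul, Int.units_mul_self, Units.val_one, Int.cast_one, one_mul]

/-- Twisting by `u` is injective on functions. [folklore] -/
private theorem mul_signFunction_injective {X : Type*} (u : X → ℤˣ) :
    Function.Injective fun (v : X → ℚ) (x : X) => ((u x : ℤ) : ℚ) * v x := by
  intro v w h
  have := congrArg (fun (v : X → ℚ) (x : X) => ((u x : ℤ) : ℚ) * v x) h
  simp only at this
  rwa [signFunction_mul_signFunction_mul u, signFunction_mul_signFunction_mul u] at this

section Twist

variable {χ : T → ℤˣ} {u : ClassSet S.O → ℤˣ} (hu : ∀ (r : T) (x : ClassSet S.O), u (S.atkinLehner r x) = χ r * u x)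
include hu

/-- **`u · φ ∈ M^{χ ε}(O)` for `φ ∈ M^ε(O)`** and a global `χ`-sign function `u`: `(uφ)(W_r x) = χ_r u(x) · ε_r φ(x)`.
[cite: Martin2018, §5.2 (proof of Thm. 12)] -/
theorem XiSetup.mul_mem_signSpace_mul {ε : T → ℤˣ} {v : ClassSet S.O → ℚ} (hv : v ∈ S.signSpace T ε) :
    (fun x => ((u x : ℤ) : ℚ) * v x) ∈ S.signSpace T (χ * ε) := by
  rw [S.mem_signSpace_iff] at hv ⊢
  intro r c
  rw [hu r c, hv r c, Pi.mul_apply, Units.val_mul, Int.cast_mul, Units.val_mul, Int.cast_mul]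
  ring

/-- `dim M^ε(O) ≤ dim M^{χ ε}(O)`: the twist embeds `M^ε` into `M^{χε}`. [cite: Martin2018, §5.2 (proof of Thm. 12)] -/
theorem XiSetup.finrank_signSpace_le_finrank_signSpace_mul (ε : T → ℤˣ) :
    Module.finrank ℚ (S.signSpace T ε) ≤ Module.finrank ℚ (S.signSpace T (χ * ε)) := by
  -- the twist as a linear map `M^ε → M^{χε}`
  let L : S.signSpace T ε →ₗ[ℚ] S.signSpace T (χ * ε) :=
    { toFun := fun v => ⟨fun x => ((u x : ℤ) : ℚ) * (v : ClassSet S.O → ℚ) x, S.mul_mem_signSpace_mul hu v.2⟩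
      map_add' := fun v w => by
        apply Subtype.ext
        funext x
        simp only [Submodule.coe_add, Pi.add_apply, mul_add]
      map_smul' := fun a v => by
        apply Subtype.ext
        funext x
        simp only [Submodule.coe_smul, Pi.smul_apply, smul_eq_mul, RingHom.id_apply]
        ring }
  have hL : Function.Injective L := by
    intro v w h
    apply Subtype.ext
    have h' := congrArg (fun z : S.signSpace T (χ * ε) => (z : ClassSet S.O → ℚ)) h
    exact mul_signFunction_injective u h'
  exact LinearMap.finrank_le_finrank_of_injective hL

end Twist

/-- **`dim M^{χ ε}(O) = dim M^ε(O)` for every `ε`, when every `T`-class is `χ`-admissible**: the twist by a global sign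
function `u_χ` is a bijection `M^ε(O) → M^{χ ε}(O)` (inverse: the same twist), so twisting by `χ` permutes the sign
spaces preserving dimensions. [cite: Martin2018, §5.2 (proof of Thm. 12) and §4.4 Cor. 8] -/
theorem XiSetup.finrank_signSpace_mul_eq_of_forall_isAdmissible {χ : T → ℤˣ}
    (h : ∀ X : S.SClassSet T, S.IsAdmissible T χ X) (ε : T → ℤˣ) :
    Module.finrank ℚ (S.signSpace T (χ * ε)) = Module.finrank ℚ (S.signSpace T ε) := by
  obtain ⟨u, hu⟩ := (S.forall_isAdmissible_iff_exists_signFunction χ).mp h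
  apply le_antisymm
  · have h2 := S.finrank_signSpace_le_finrank_signSpace_mul hu (χ * ε)
    have e : χ * (χ * ε) = ε := by
      funext r
      rw [Pi.mul_apply, Pi.mul_apply, ← mul_assoc, Int.units_mul_self, one_mul]
    rwa [e] at h2
  · exact S.finrank_signSpace_le_finrank_signSpace_mul hu ε

/-- Cor. 8 recovered structurally: all classes `χ`-admissible ⇒ `dim M^χ(O) = dim M^{+_T}(O)`. [cite: Martin2018, §4.4 Cor. 8] -/
theorem XiSetup.finrank_signSpace_eq_finrank_signSpace_one_of_forall_isAdmissible {χ : T → ℤˣ}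
    (h : ∀ X : S.SClassSet T, S.IsAdmissible T χ X) :
    Module.finrank ℚ (S.signSpace T χ) = Module.finrank ℚ (S.signSpace T 1) := by
  have := S.finrank_signSpace_mul_eq_of_forall_isAdmissible h 1
  rwa [mul_one] at this

/-- **`M^{χ ε}(O) = u_χ · M^ε(O)`** (as sets of functions) when `u_χ` is a global `χ`-sign function: every form of
pattern `χ ε` is the twist of a form of pattern `ε`. [cite: Martin2018, §5.2 (proof of Thm. 12)] -/
theorem XiSetup.mem_signSpace_mul_iff_exists {χ : T → ℤˣ} {u : ClassSet S.O → ℤˣ}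
    (hu : ∀ (r : T) (x : ClassSet S.O), u (S.atkinLehner r x) = χ r * u x) (ε : T → ℤˣ) (w : ClassSet S.O → ℚ) :
    w ∈ S.signSpace T (χ * ε) ↔ ∃ v ∈ S.signSpace T ε, w = fun x => ((u x : ℤ) : ℚ) * v x := by
  constructor
  · intro hw
    refine ⟨fun x => ((u x : ℤ) : ℚ) * w x, ?_, (signFunction_mul_signFunction_mul u w).symm⟩
    have e : χ * (χ * ε) = ε := by
      funext r
      rw [Pi.mul_apply, Pi.mul_apply, ← mul_assoc, Int.units_mul_self, one_mul]
    have := S.mul_mem_signSpace_mul hu hw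
    rwa [e] at this
  · rintro ⟨v, hv, rfl⟩
    exact S.mul_mem_signSpace_mul hu hv

/-- **`M^χ(O) = u_χ · M^{+_T}(O)`**: under `χ`-admissibility of all classes, the forms of pattern `χ` are exactly the
sign twists of the `T`-class functions (the functions on `Cl_T(O)`). [cite: Martin2018, §5.2 (proof of Thm. 12: "`φ'(x_i) = φ(x_i)`, extend by `χ`") and (3.8)] -/
theorem XiSetup.mem_signSpace_iff_exists_comp_sClassOf {χ : T → ℤˣ} {u : ClassSet S.O → ℤˣ}
    (hu : ∀ (r : T) (x : ClassSet S.O), u (S.atkinLehner r x) = χ r * u x) (w : ClassSet S.O → ℚ) :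
    w ∈ S.signSpace T χ ↔ ∃ g : S.SClassSet T → ℚ, w = fun x => ((u x : ℤ) : ℚ) * g (S.sClassOf T x) := by
  have key := S.mem_signSpace_mul_iff_exists hu 1 w
  rw [mul_one] at key
  rw [key]
  constructor
  · rintro ⟨v, hv, rfl⟩
    obtain ⟨g, rfl⟩ := (S.mem_signSpace_one_iff_exists_comp_sClassOf T v).mp hv
    exact ⟨g, rfl⟩
  · rintro ⟨g, rfl⟩
    exact ⟨g ∘ S.sClassOf T, (S.mem_signSpace_one_iff_exists_comp_sClassOf T _).mpr ⟨g, rfl⟩, rfl⟩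

/-! ## §3 Martin's Theorem 12 in weight zero: sign-twisted forms congruent mod `2` -/

/-- **THEOREM 12 (weight-`0` core).** If every `T`-class is `χ`-admissible and `φ ∈ M^ε(O)` for some sign pattern `ε`,
there is `φ' ∈ M^χ(O)` with `φ'(x) = ± φ(x)` at EVERY class `x`, agreeing with `φ` at a chosen base point of each
`T`-class, and `φ' ≠ 0` if `φ ≠ 0` (Martin: "`φ'(x_i) = φ(x_i)` for `1 ≤ i ≤ t` … `φ' ∈ M_k^χ(O)` … and
`φ'(x_i) = ± φ(x_i)` for `1 ≤ i ≤ h`"). [cite: Martin2018, §5.2 Thm. 12 (proof)] -/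
theorem XiSetup.exists_mem_signSpace_eq_or_eq_neg {χ ε : T → ℤˣ} (h : ∀ X : S.SClassSet T, S.IsAdmissible T χ X)
    {v : ClassSet S.O → ℚ} (hv : v ∈ S.signSpace T ε) (ρ : S.SClassSet T → ClassSet S.O)
    (hρ : ∀ X, S.sClassOf T (ρ X) = X) :
    ∃ v' ∈ S.signSpace T χ, (∀ x, v' x = v x ∨ v' x = -v x) ∧ (∀ X, v' (ρ X) = v (ρ X)) := by
  obtain ⟨u, hu⟩ := (S.forall_isAdmissible_iff_exists_signFunction χ).mp h
  -- `φ' = u · ψ` with `ψ` the class function `x ↦ u(ρ_X) φ(ρ_X)`, `X = [x]_T`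
  refine ⟨fun x => ((u x : ℤ) : ℚ) * (((u (ρ (S.sClassOf T x)) : ℤ) : ℚ) * v (ρ (S.sClassOf T x))), ?_, ?_, ?_⟩
  · exact (S.mem_signSpace_iff_exists_comp_sClassOf hu _).mpr
      ⟨fun X => ((u (ρ X) : ℤ) : ℚ) * v (ρ X), rfl⟩
  · intro x
    show ((u x : ℤ) : ℚ) * (((u (ρ (S.sClassOf T x)) : ℤ) : ℚ) * v (ρ (S.sClassOf T x))) = v x ∨
      ((u x : ℤ) : ℚ) * (((u (ρ (S.sClassOf T x)) : ℤ) : ℚ) * v (ρ (S.sClassOf T x))) = -v x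
    -- `x = Φ(g) ρ_X`: `u(x) = χ(g) u(ρ_X)` and `φ(x) = ε(g) φ(ρ_X)`
    have hx : S.sClassOf T (ρ (S.sClassOf T x)) = S.sClassOf T x := hρ _
    obtain ⟨g, hg⟩ := (S.sClassOf_eq_sClassOf_iff_exists_atkinLehnerHom T _ x).mp hx
    set y := ρ (S.sClassOf T x) with hy
    have hux : u x = signCharacter T χ g * u y := by rw [← hg]; exact S.apply_atkinLehnerHom_of_signFunction hu g y
    have hvx : v x = ((signCharacter T ε g : ℤ) : ℚ) * v y := by
      rw [← hg]; exact S.apply_atkinLehnerHom_of_mem_signSpace T hv g y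
    rw [hux, hvx, Units.val_mul, Int.cast_mul]
    have huu : ((u y : ℤ) : ℚ) * ((u y : ℤ) : ℚ) = 1 := by
      rw [← Int.cast_mul, ← Units.val_mul, Int.units_mul_self, Units.val_one, Int.cast_one]
    rcases signCharacter_cast_eq T χ g with h1 | h1 <;> rcases signCharacter_cast_eq T ε g with h2 | h2 <;>
      rw [h1, h2]
    · left; linear_combination (v y) * huu
    · right; linear_combination (v y) * huu
    · right; linear_combination (-(v y)) * huu
    · left; linear_combination (-(v y)) * huu
  · intro X
    show ((u (ρ X) : ℤ) : ℚ) * (((u (ρ (S.sClassOf T (ρ X))) : ℤ) : ℚ) * v (ρ (S.sClassOf T (ρ X)))) = v (ρ X)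
    rw [hρ X, ← mul_assoc, ← Int.cast_mul, ← Units.val_mul, Int.units_mul_self, Units.val_one, Int.cast_one, one_mul]

/-- The twisted form is nonzero when `φ` is. [cite: Martin2018, §5.2 Thm. 12 (proof: "`φ ≢ 0 mod 𝓘`")] -/
theorem XiSetup.exists_mem_signSpace_eq_or_eq_neg_ne_zero {χ ε : T → ℤˣ} (h : ∀ X : S.SClassSet T, S.IsAdmissible T χ X)
    {v : ClassSet S.O → ℚ} (hv : v ∈ S.signSpace T ε) (hv0 : v ≠ 0) :
    ∃ v' ∈ S.signSpace T χ, (∀ x, v' x = v x ∨ v' x = -v x) ∧ v' ≠ 0 := by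
  let ρ : S.SClassSet T → ClassSet S.O := fun X => (S.sClassOf_surjective T X).choose
  have hρ : ∀ X, S.sClassOf T (ρ X) = X := fun X => (S.sClassOf_surjective T X).choose_spec
  obtain ⟨v', hv', hpm, hbase⟩ := S.exists_mem_signSpace_eq_or_eq_neg h hv ρ hρ
  refine ⟨v', hv', hpm, fun h0 => hv0 ?_⟩
  -- if `φ'` vanished, `φ` would vanish at every base point, hence everywhere
  funext x
  have hx : S.sClassOf T (ρ (S.sClassOf T x)) = S.sClassOf T x := hρ _
  obtain ⟨g, hg⟩ := (S.sClassOf_eq_sClassOf_iff_exists_atkinLehnerHom T _ x).mp hx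
  rw [← hg, S.apply_atkinLehnerHom_of_mem_signSpace T hv g, ← hbase, h0, Pi.zero_apply, mul_zero, Pi.zero_apply]

/-- **"`φ' ≡ φ mod 2` with respect to `x_1, …, x_h`"**: for an INTEGRAL form `φ ∈ M^ε(O)` (integer values at every
class) and `χ` admissible on every class, the twisted `φ' ∈ M^χ(O)` is integral and `φ'(x) − φ(x) ∈ 2ℤ` for all `x`.
[cite: Martin2018, §5.1 (integral forms) and §5.2 Thm. 12 (proof)] -/
theorem XiSetup.exists_mem_signSpace_sub_even {χ ε : T → ℤˣ} (h : ∀ X : S.SClassSet T, S.IsAdmissible T χ X)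
    {v : ClassSet S.O → ℚ} (hv : v ∈ S.signSpace T ε) (hint : ∀ x, ∃ n : ℤ, v x = n) :
    ∃ v' ∈ S.signSpace T χ, (∀ x, ∃ n : ℤ, v' x = n) ∧ ∀ x, ∃ m : ℤ, v' x - v x = 2 * m := by
  let ρ : S.SClassSet T → ClassSet S.O := fun X => (S.sClassOf_surjective T X).choose
  have hρ : ∀ X, S.sClassOf T (ρ X) = X := fun X => (S.sClassOf_surjective T X).choose_spec
  obtain ⟨v', hv', hpm, -⟩ := S.exists_mem_signSpace_eq_or_eq_neg h hv ρ hρ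
  refine ⟨v', hv', fun x => ?_, fun x => ?_⟩
  · obtain ⟨n, hn⟩ := hint x
    rcases hpm x with h1 | h1
    · exact ⟨n, by rw [h1, hn]⟩
    · exact ⟨-n, by rw [h1, hn, Int.cast_neg]⟩
  · obtain ⟨n, hn⟩ := hint x
    rcases hpm x with h1 | h1
    · exact ⟨0, by rw [h1, sub_self, Int.cast_zero, mul_zero]⟩
    · exact ⟨-n, by rw [h1, hn, Int.cast_neg]; ring⟩

/-- **COROLLARY 14 (weight-`0` core): the trivial pattern is admissible on every class, so every `φ ∈ M^ε(O)` has a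
twist `φ' ∈ M^{+_T}(O)` (a function of the `T`-class) with `φ'(x) = ± φ(x)` everywhere** ("since, in weight `0`, all
quaternionic `S`-ideal classes are `+_𝔐`-admissible, the above theorem also gives …"). [cite: Martin2018, §5.2 Cor. 14] -/
theorem XiSetup.exists_mem_signSpace_one_eq_or_eq_neg {ε : T → ℤˣ} {v : ClassSet S.O → ℚ} (hv : v ∈ S.signSpace T ε)
    (hv0 : v ≠ 0) : ∃ v' ∈ S.signSpace T 1, (∀ x, v' x = v x ∨ v' x = -v x) ∧ v' ≠ 0 :=
  S.exists_mem_signSpace_eq_or_eq_neg_ne_zero (fun X => S.isAdmissible_one X) hv hv0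

/-- The converse direction of Theorem 12's construction: a form of pattern `χ` not vanishing at a base point of every
class forces `χ`-admissibility everywhere (Prop. 7). [cite: Martin2018, §4.4 Prop. 7 (proof)] -/
theorem XiSetup.forall_isAdmissible_of_mem_signSpace_forall_ne_zero {χ : T → ℤˣ} {v : ClassSet S.O → ℚ}
    (hv : v ∈ S.signSpace T χ) (hne : ∀ X : S.SClassSet T, ∃ x, S.sClassOf T x = X ∧ v x ≠ 0) :
    ∀ X : S.SClassSet T, S.IsAdmissible T χ X := by
  intro X
  obtain ⟨x, rfl, hx⟩ := hne X
  exact S.isAdmissible_of_mem_signSpace_of_ne_zero hv hx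

end Brandt

end Literature.NumberTheory.Automorphic
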